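import Summits.QuantumFields.YangMills.Theorems.AllWindowsColdBoxJaffardDecayBootstrap
import Summits.QuantumFields.YangMills.Theorems.AllWindowsColdBoxJaffardDecayTools

/-!
# Jaffard's theorem: the inverse of a boundedly invertible matrix with polynomial off-diagonal decay has the same decay
# (finite index sets, constants uniform in the index set) — LINE-18 stub K1 `DirKernelDipoleDecay`, item K1-J
# (crux `AllWindowsColdBox.BulkMidWindowSU2`, stmt-QuantumFields-24006; planner ym-idea-2, STUB-PLAN-K1-24006 §1 (J) / §2 K1-J)

S. Jaffard, «Propriétés des matrices bien localisées près de leur diagonale et quelques applications», Ann. Inst. H. Poincaré Anal.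
Non Linéaire 7 (1990) 461–476, Proposition 3: if `|M(x,y)| ≤ C (1 + d(x,y))^{−r}` on an index set of `D`-dimensional growth, `r > D`,
and `M` is boundedly invertible on `ℓ²`, then `|M⁻¹(x,y)| ≤ C' (1 + d(x,y))^{−r}` with the SAME exponent `r` and `C'` depending only on
`(C, r, D, c_S, spectral bounds)`.  This file states and proves the finite-index-set, positive-definite version that LINE-18 needs (the
boundary-stratum Gram matrix `G_N` of STUB-PLAN-K1 §1(iii): `m₀ = 1/16` by `‖Δ^rel‖ ≤ 16`, decay exponent `r = 4` on `2`-dimensional strata):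
* (tools file) `sq_mulVec_le_of_form` — a symmetric matrix with `0 ≤ vᵀRv ≤ q‖v‖²` is an `ℓ²`-contraction; `tail_sum_le_of_growth` —
  the tail hypothesis from volume growth;
* `inverse_decay_of_contraction` — **contraction form**: for `0 < D < r`, `c_S > 0`, `0 < q < 1`, `c_R` there is `C = C(r, D, c_S, q, c_R)`
  such that for EVERY finite index set with a pseudo-distance of `D`-dimensional growth and every symmetric `ℓ²`-contraction `R` with
  `|R x y|(1+d x y)^r ≤ c_R`: `|((1−R)⁻¹) x y| (1+d x y)^r ≤ C` and `Σ_z |((1−R)⁻¹) z y| ≤ C` (parts 1–2: two-norm inequality, dyadic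
  bootstrap `‖R^{2n}‖_r ≤ 2^{r+1}‖Rⁿ‖_r col(Rⁿ)` with `col(Rⁿ) ≤ 2√c_S qⁿ max(1, √c_S‖Rⁿ‖_r/qⁿ)^{D/(2r−D)}`, product formula
  `(1−R)⁻¹ = Π_k (1 + R^{2^k})`);
* `inverse_decay_of_posDef` — **positive-definite form** (the statement consumed by K1-E/F): for `0 < D < r`, `c_S > 0`, `m₀ > 0`, `C ≥ 0`
  there is `C' = C'(r, D, c_S, m₀, C)` such that for every finite index set with a symmetric pseudo-distance of `D`-dimensional growth and
  every symmetric `M` with `m₀‖v‖² ≤ vᵀMv` and `|M x y|(1+d x y)^r ≤ C`: `|M⁻¹ x y| (1+d x y)^r ≤ C'` and `Σ_z |M⁻¹ z y| ≤ C'`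
  (`R = 1 − M/(C c_S + 2m₀)`, Schur's test for the upper spectral bound).
The constants are existentially quantified BEFORE the index set, which is exactly the `H`-uniformity the dipole law needs.  Pure Mathlib
(via parts 1–2); no definitions; standard axioms.

HONEST LABEL: a classical lemma (helper) toward one registered stub (K1, OPEN: the estimate (T) and the linear algebra K1-B/C/D remain) of a
critic-passed line on the R2ξ″ RECORD-rung crux 24006; no stub, crux, rung or summit is proved here; the Yang–Mills mass gap is NOT proved
by this file.
-/

set_option autoImplicit false

open Finset Matrix

namespace Summit.QuantumFields.YangMills.Theorems.AllWindowsColdBox.Jaffard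

universe u

/-- **Jaffard's theorem, contraction form.**  Fix `0 < D < r`, `c_S > 0`, `0 < q < 1`, `c_R`.  There is a constant `C`, depending on these
numbers only, such that: for every finite index set with a pseudo-distance `d` of `D`-dimensional growth (volume `#{d(·,y) ≤ ρ} ≤ c_S(1+ρ)^D`
and tails `Σ_{ρ ≤ d(z,y)} (1+d(z,y))^{−r} ≤ c_S (1+ρ)^{D−r}`) and every symmetric `ℓ²`-contraction `R` (`‖Rv‖₂ ≤ q‖v‖₂`) with
`|R x y| ≤ c_R (1+d x y)^{−r}`, the inverse `(1 − R)⁻¹ = Σ Rⁿ` satisfies `|((1−R)⁻¹) x y| ≤ C (1+d x y)^{−r}` and has column sums `≤ C`. -/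
theorem inverse_decay_of_contraction {r D cS q cR : ℝ} (hD : 0 < D) (hDr : D < r) (hcS : 0 < cS)
    (hq : 0 < q) (hq1 : q < 1) :
    ∃ C : ℝ, 0 ≤ C ∧ ∀ {ι : Type u} [Fintype ι] [DecidableEq ι] (d : ι → ι → ℝ),
      (∀ x y, 0 ≤ d x y) → (∀ x, d x x = 0) → (∀ x y z, d x y ≤ d x z + d z y) →
      (∀ (y : ι) (ρ : ℝ), 0 ≤ ρ → ((Finset.univ.filter (fun z => d z y ≤ ρ)).card : ℝ) ≤ cS * (1 + ρ) ^ D) →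
      (∀ (y : ι) (ρ : ℝ), 0 ≤ ρ →
        ∑ z ∈ Finset.univ.filter (fun z => ρ ≤ d z y), ((1 + d z y) ^ r)⁻¹ ≤ cS * (1 + ρ) ^ (D - r)) →
      ∀ (R : Matrix ι ι ℝ), R.IsSymm → (∀ v : ι → ℝ, ∑ x, (R *ᵥ v) x ^ 2 ≤ q ^ 2 * ∑ x, v x ^ 2) →
        (∀ x y, |R x y| * (1 + d x y) ^ r ≤ cR) →
        (∀ x y, |((1 - R)⁻¹) x y| * (1 + d x y) ^ r ≤ C) ∧ (∀ y, ∑ z, |((1 - R)⁻¹) z y| ≤ C) := by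
  -- the parameter-only constants
  set θ : ℝ := D / (2 * r - D) with hθ
  have hθ0 : 0 < θ := div_pos hD (by linarith)
  have hθ1 : θ < 1 := (div_lt_one (by linarith)).2 (by linarith)
  set Θ : ℝ := max 1 (4 * 2 ^ r * Real.sqrt cS) with hΘ
  set G₀ : ℝ := max 1 (Real.sqrt cS * cR / q) with hG₀
  set Γ : ℝ := Real.log G₀ + Real.log Θ / θ with hΓ
  have hΓ0 : 0 ≤ Γ := add_nonneg (Real.log_nonneg (le_max_left _ _)) (div_nonneg (Real.log_nonneg (le_max_left _ _)) hθ0.le)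
  obtain ⟨S, hS⟩ := exists_sum_bound Γ θ q hΓ0 hθ0.le hθ1 hq hq1
  set c₂ : ℝ := 2 ^ r * (2 * Real.sqrt cS + (Real.sqrt cS)⁻¹) with hc₂
  have hsq0 : 0 < Real.sqrt cS := Real.sqrt_pos.2 hcS
  have hc₂0 : 0 ≤ c₂ := by positivity
  have h2r : (0 : ℝ) ≤ 2 ^ r := Real.rpow_nonneg (by norm_num) r
  refine ⟨Real.exp (c₂ * S), (Real.exp_pos _).le, ?_⟩
  intro ι _ _ d hd0 hdd htri hG1 hG2 R hsymm hR hdecR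
  have hr0 : 0 ≤ r := by linarith
  -- closed-form per-level bounds
  set u : ℕ → ℝ := fun k => q ^ (2 ^ k) * Real.exp ((1 + θ) ^ k * Γ) / Real.sqrt cS with hu
  set c : ℕ → ℝ := fun k => 2 * Real.sqrt cS * (q ^ (2 ^ k) * Real.exp ((1 + θ) ^ k * Γ)) with hc
  have hu0 : ∀ k, 0 ≤ u k := fun k => by positivity
  have hc0 : ∀ k, 0 ≤ c k := fun k => by positivity
  have hlevel : ∀ k, (∀ x y, |(R ^ (2 ^ k)) x y| * (1 + d x y) ^ r ≤ u k) ∧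
      (∀ y, ∑ z, |(R ^ (2 ^ k)) z y| ≤ c k) := by
    intro k
    obtain ⟨g, hg1, hlog, hdec, hcol⟩ :=
      decay_pow_two_pow_le d hD hDr hcS hq hd0 htri hG1 hG2 hsymm hR hdecR k
    have hlog' : Real.log g ≤ (1 + θ) ^ k * Γ - Real.log Θ / θ := hlog
    have hcol' : ∀ y, ∑ z, |(R ^ (2 ^ k)) z y| ≤ 2 * Real.sqrt cS * q ^ (2 ^ k) * g ^ θ := hcol
    have hg0 : 0 < g := lt_of_lt_of_le one_pos hg1
    have hgexp : g ≤ Real.exp ((1 + θ) ^ k * Γ) := by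
      rw [← Real.exp_log hg0]
      refine Real.exp_le_exp.2 ?_
      have : 0 ≤ Real.log Θ / θ := div_nonneg (Real.log_nonneg (le_max_left _ _)) hθ0.le
      linarith
    have hgθ : g ^ θ ≤ Real.exp ((1 + θ) ^ k * Γ) :=
      (Real.rpow_le_rpow_of_exponent_le hg1 hθ1.le).trans (by rw [Real.rpow_one]; exact hgexp)
    refine ⟨fun x y => (hdec x y).trans ?_, fun y => (hcol' y).trans ?_⟩
    · exact div_le_div_of_nonneg_right (mul_le_mul_of_nonneg_left hgexp (pow_nonneg hq.le _)) hsq0.le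
    · have h2 : 0 ≤ 2 * Real.sqrt cS * q ^ (2 ^ k) := by positivity
      calc 2 * Real.sqrt cS * q ^ (2 ^ k) * g ^ θ ≤ 2 * Real.sqrt cS * q ^ (2 ^ k) * Real.exp ((1 + θ) ^ k * Γ) :=
            mul_le_mul_of_nonneg_left hgθ h2
        _ = c k := by rw [hc]; ring
  -- partial sums are bounded by `exp (c₂ S)`
  have hP : ∀ K : ℕ, (∀ x y, |(∑ n ∈ Finset.range (2 ^ K), R ^ n) x y| * (1 + d x y) ^ r ≤ Real.exp (c₂ * S)) ∧
      (∀ y, ∑ z, |(∑ n ∈ Finset.range (2 ^ K), R ^ n) z y| ≤ Real.exp (c₂ * S)) := by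
    intro K
    obtain ⟨h1, h2, -⟩ := partialSum_le d hr0 hd0 hdd htri hsymm u c hu0 hc0
      (fun k => (hlevel k).1) (fun k => (hlevel k).2) K
    have hprod : ∏ k ∈ Finset.range K, (1 + 2 ^ r * (c k + u k)) ≤ Real.exp (c₂ * S) := by
      calc ∏ k ∈ Finset.range K, (1 + 2 ^ r * (c k + u k))
            ≤ ∏ k ∈ Finset.range K, Real.exp (2 ^ r * (c k + u k)) :=
            Finset.prod_le_prod (fun k _ => by have := hu0 k; have := hc0 k; positivity)
              fun k _ => by linarith [Real.add_one_le_exp (2 ^ r * (c k + u k))]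
        _ = Real.exp (∑ k ∈ Finset.range K, 2 ^ r * (c k + u k)) := (Real.exp_sum _ _).symm
        _ = Real.exp (c₂ * ∑ k ∈ Finset.range K, q ^ (2 ^ k) * Real.exp ((1 + θ) ^ k * Γ)) := by
            congr 1
            rw [Finset.mul_sum]
            refine Finset.sum_congr rfl fun k _ => ?_
            simp only [hc₂, hu, hc, div_eq_mul_inv]
            ring
        _ ≤ Real.exp (c₂ * S) := Real.exp_le_exp.2 (mul_le_mul_of_nonneg_left (hS K) hc₂0)
    exact ⟨fun x y => (h1 x y).trans hprod, fun y => (h2 y).trans hprod⟩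
  exact inv_one_sub_le d hq.le hq1 hd0 hsymm hR hP

/-- **Jaffard's theorem for positive definite matrices** (S. Jaffard 1990, Prop. 3; finite-index-set form with uniform constants).
Fix `0 < D < r`, `c_S > 0`, `m₀ > 0`, `C ≥ 0`.  There is `C'`, depending on these numbers only, such that: for every finite index set with
a symmetric pseudo-distance `d` of `D`-dimensional growth (as above) and every symmetric matrix `M` with `m₀‖v‖² ≤ vᵀMv` and
`|M x y| ≤ C (1+d x y)^{−r}`, the inverse satisfies `|M⁻¹ x y| ≤ C' (1+d x y)^{−r}` and has column sums `≤ C'`.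
(The upper spectral bound comes for free from the decay by Schur's test: `vᵀMv ≤ C c_S ‖v‖²`.) -/
theorem inverse_decay_of_posDef {r D cS m₀ C : ℝ} (hD : 0 < D) (hDr : D < r) (hcS : 0 < cS) (hm : 0 < m₀)
    (hC : 0 ≤ C) :
    ∃ C' : ℝ, 0 ≤ C' ∧ ∀ {ι : Type u} [Fintype ι] [DecidableEq ι] (d : ι → ι → ℝ),
      (∀ x y, 0 ≤ d x y) → (∀ x, d x x = 0) → (∀ x y, d x y = d y x) → (∀ x y z, d x y ≤ d x z + d z y) →
      (∀ (y : ι) (ρ : ℝ), 0 ≤ ρ → ((Finset.univ.filter (fun z => d z y ≤ ρ)).card : ℝ) ≤ cS * (1 + ρ) ^ D) →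
      (∀ (y : ι) (ρ : ℝ), 0 ≤ ρ →
        ∑ z ∈ Finset.univ.filter (fun z => ρ ≤ d z y), ((1 + d z y) ^ r)⁻¹ ≤ cS * (1 + ρ) ^ (D - r)) →
      ∀ (M : Matrix ι ι ℝ), M.IsSymm → (∀ v : ι → ℝ, m₀ * ∑ x, v x ^ 2 ≤ v ⬝ᵥ (M *ᵥ v)) →
        (∀ x y, |M x y| * (1 + d x y) ^ r ≤ C) →
        (∀ x y, |M⁻¹ x y| * (1 + d x y) ^ r ≤ C') ∧ (∀ y, ∑ z, |M⁻¹ z y| ≤ C') := by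
  set M₀ : ℝ := C * cS + 2 * m₀ with hM₀
  have hM₀0 : 0 < M₀ := by positivity
  set t : ℝ := M₀⁻¹ with ht
  have ht0 : 0 < t := inv_pos.2 hM₀0
  set q : ℝ := 1 - m₀ * t with hq
  have hmt : m₀ * t < 1 := by
    rw [ht, ← div_eq_mul_inv, div_lt_one hM₀0, hM₀]; nlinarith
  have hq0 : 0 < q := by rw [hq]; linarith
  have hq1 : q < 1 := by rw [hq]; nlinarith [mul_pos hm ht0]
  obtain ⟨CA, hCA0, hA⟩ :=
    inverse_decay_of_contraction (cR := 1 + t * C) hD hDr hcS hq0 hq1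
  refine ⟨t * CA, by positivity, ?_⟩
  intro ι _ _ d hd0 hdd hdsymm htri hG1 hG2 M hsymm hcoer hdec
  -- weights and row sums (Schur)
  have hw1 : ∀ x y, 1 ≤ (1 + d x y) ^ r := fun x y => Real.one_le_rpow (by linarith [hd0 x y]) (by linarith)
  have hentry : ∀ x y, |M x y| ≤ C * ((1 + d x y) ^ r)⁻¹ := by
    intro x y
    have hw : 0 < (1 + d x y) ^ r := lt_of_lt_of_le one_pos (hw1 x y)
    rw [← div_eq_mul_inv, le_div_iff₀ hw]
    exact hdec x y
  have hcolw : ∀ y, ∑ z, ((1 + d z y) ^ r)⁻¹ ≤ cS := by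
    intro y
    have h := hG2 y 0 le_rfl
    rw [Finset.filter_true_of_mem (fun z _ => hd0 z y)] at h
    simpa [Real.one_rpow] using h
  have hcolM : ∀ y, ∑ z, |M z y| ≤ C * cS := fun y =>
    calc ∑ z, |M z y| ≤ ∑ z, C * ((1 + d z y) ^ r)⁻¹ := Finset.sum_le_sum fun z _ => hentry z y
      _ = C * ∑ z, ((1 + d z y) ^ r)⁻¹ := by rw [Finset.mul_sum]
      _ ≤ C * cS := mul_le_mul_of_nonneg_left (hcolw y) hC
  have hrowM : ∀ x, ∑ z, |M x z| ≤ C * cS := fun x =>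
    calc ∑ z, |M x z| = ∑ z, |M z x| := Finset.sum_congr rfl fun z _ => by rw [hsymm.apply z x]
      _ ≤ C * cS := hcolM x
  -- the quadratic form is bounded above by `C c_S ‖v‖²`
  have hform : ∀ v : ι → ℝ, v ⬝ᵥ (M *ᵥ v) ≤ C * cS * ∑ x, v x ^ 2 := by
    intro v
    have hexp : v ⬝ᵥ (M *ᵥ v) = ∑ x, ∑ y, M x y * (v x * v y) := by
      simp only [dotProduct, Matrix.mulVec, Finset.mul_sum]
      exact Finset.sum_congr rfl fun x _ => Finset.sum_congr rfl fun y _ => by ring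
    rw [hexp]
    have hA1 : ∑ x, ∑ y, |M x y| * v x ^ 2 ≤ C * cS * ∑ x, v x ^ 2 := by
      calc ∑ x, ∑ y, |M x y| * v x ^ 2 = ∑ x, (∑ y, |M x y|) * v x ^ 2 :=
            Finset.sum_congr rfl fun x _ => by rw [Finset.sum_mul]
        _ ≤ ∑ x, (C * cS) * v x ^ 2 :=
            Finset.sum_le_sum fun x _ => mul_le_mul_of_nonneg_right (hrowM x) (sq_nonneg _)
        _ = C * cS * ∑ x, v x ^ 2 := by rw [Finset.mul_sum]
    have hA2 : ∑ x, ∑ y, |M x y| * v y ^ 2 ≤ C * cS * ∑ x, v x ^ 2 := by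
      rw [Finset.sum_comm]
      calc ∑ y, ∑ x, |M x y| * v y ^ 2 = ∑ y, (∑ x, |M x y|) * v y ^ 2 :=
            Finset.sum_congr rfl fun y _ => by rw [Finset.sum_mul]
        _ ≤ ∑ y, (C * cS) * v y ^ 2 :=
            Finset.sum_le_sum fun y _ => mul_le_mul_of_nonneg_right (hcolM y) (sq_nonneg _)
        _ = C * cS * ∑ x, v x ^ 2 := by rw [Finset.mul_sum]
    calc ∑ x, ∑ y, M x y * (v x * v y) ≤ ∑ x, ∑ y, (|M x y| * v x ^ 2 / 2 + |M x y| * v y ^ 2 / 2) := by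
          refine Finset.sum_le_sum fun x _ => Finset.sum_le_sum fun y _ => ?_
          have h1 : M x y * (v x * v y) ≤ |M x y| * (|v x| * |v y|) := by
            rw [← abs_mul, ← abs_mul]; exact le_abs_self _
          have h2 : |v x| * |v y| ≤ (v x ^ 2 + v y ^ 2) / 2 := by
            nlinarith [sq_nonneg (|v x| - |v y|), sq_abs (v x), sq_abs (v y)]
          nlinarith [mul_le_mul_of_nonneg_left h2 (abs_nonneg (M x y))]
      _ = (∑ x, ∑ y, |M x y| * v x ^ 2) / 2 + (∑ x, ∑ y, |M x y| * v y ^ 2) / 2 := by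
          simp only [Finset.sum_add_distrib, Finset.sum_div]
      _ ≤ C * cS * ∑ x, v x ^ 2 := by linarith
  -- `R = 1 - t M`
  set R : Matrix ι ι ℝ := 1 - t • M with hR
  have hRsymm : R.IsSymm := by
    rw [Matrix.IsSymm, hR, Matrix.transpose_sub, Matrix.transpose_one, Matrix.transpose_smul, hsymm.eq]
  have hRform : ∀ v : ι → ℝ, v ⬝ᵥ (R *ᵥ v) = ∑ x, v x ^ 2 - t * (v ⬝ᵥ (M *ᵥ v)) := by
    intro v
    rw [hR, Matrix.sub_mulVec, Matrix.one_mulVec, Matrix.smul_mulVec, dotProduct_sub, dotProduct_smul,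
      smul_eq_mul, dotProduct]
    congr 1
    exact Finset.sum_congr rfl fun x _ => by ring
  have hpsd : ∀ v : ι → ℝ, 0 ≤ v ⬝ᵥ (R *ᵥ v) := by
    intro v
    rw [hRform]
    have h1 := hform v
    have hv0 : 0 ≤ ∑ x, v x ^ 2 := Finset.sum_nonneg fun x _ => sq_nonneg _
    have h2 : t * (C * cS) ≤ 1 := by
      rw [ht, ← div_eq_inv_mul, div_le_one hM₀0, hM₀]; linarith
    nlinarith [mul_le_mul_of_nonneg_left h1 ht0.le, mul_le_mul_of_nonneg_right h2 hv0]
  have hformR : ∀ v : ι → ℝ, v ⬝ᵥ (R *ᵥ v) ≤ q * ∑ x, v x ^ 2 := by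
    intro v
    rw [hRform, hq]
    nlinarith [mul_le_mul_of_nonneg_left (hcoer v) ht0.le]
  have hcontr := sq_mulVec_le_of_form hRsymm hpsd hformR
  have hdecR : ∀ x y, |R x y| * (1 + d x y) ^ r ≤ 1 + t * C := by
    intro x y
    by_cases hxy : x = y
    · subst hxy
      rw [hdd, add_zero, Real.one_rpow, mul_one, hR, Matrix.sub_apply, Matrix.one_apply_eq, Matrix.smul_apply,
        smul_eq_mul]
      have h1 : |M x x| ≤ C := by have := hdec x x; rwa [hdd, add_zero, Real.one_rpow, mul_one] at this
      calc |1 - t * M x x| ≤ |(1 : ℝ)| + |t * M x x| := abs_sub _ _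
        _ = 1 + t * |M x x| := by rw [abs_one, abs_mul, abs_of_pos ht0]
        _ ≤ 1 + t * C := by nlinarith [h1, ht0]
    · rw [hR, Matrix.sub_apply, Matrix.one_apply_ne hxy, Matrix.smul_apply, smul_eq_mul, zero_sub, abs_neg, abs_mul,
        abs_of_pos ht0, mul_assoc]
      nlinarith [hdec x y, ht0]
  obtain ⟨hAd, hAc⟩ := hA d hd0 hdd htri hG1 hG2 R hRsymm hcontr hdecR
  -- `M⁻¹ = t (1 - R)⁻¹`
  have hdet : IsUnit (1 - R).det := isUnit_det_one_sub hq0.le hq1 hcontr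
  have h1R : 1 - R = t • M := by rw [hR, sub_sub_cancel]
  have hMinv : M⁻¹ = t • (1 - R)⁻¹ := by
    refine Matrix.inv_eq_right_inv ?_
    rw [Matrix.mul_smul, ← Matrix.smul_mul, ← h1R, Matrix.mul_nonsing_inv _ hdet]
  refine ⟨fun x y => ?_, fun y => ?_⟩
  · rw [hMinv, Matrix.smul_apply, smul_eq_mul, abs_mul, abs_of_pos ht0, mul_assoc]
    exact mul_le_mul_of_nonneg_left (hAd x y) ht0.le
  · calc ∑ z, |M⁻¹ z y| = t * ∑ z, |((1 - R)⁻¹) z y| := by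
          rw [hMinv, Finset.mul_sum]
          exact Finset.sum_congr rfl fun z _ => by rw [Matrix.smul_apply, smul_eq_mul, abs_mul, abs_of_pos ht0]
      _ ≤ t * CA := mul_le_mul_of_nonneg_left (hAc y) ht0.le

/-- **Jaffard's theorem for positive definite matrices, volume-growth form**: as `inverse_decay_of_posDef`, but assuming only the volume
growth `#{z : d z y ≤ ρ} ≤ c_S (1+ρ)^D` of the index set (the tail hypothesis follows by `tail_sum_le_of_growth`, with the constant
`c_S 2^D (1 − 2^{D−r})⁻¹`).  This is the form to instantiate on lattice strata (`d` = a lattice distance, `D` = the dimension of the stratum). -/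
theorem inverse_decay_of_posDef_of_growth {r D cS m₀ C : ℝ} (hD : 0 < D) (hDr : D < r) (hcS : 0 < cS) (hm : 0 < m₀)
    (hC : 0 ≤ C) :
    ∃ C' : ℝ, 0 ≤ C' ∧ ∀ {ι : Type u} [Fintype ι] [DecidableEq ι] (d : ι → ι → ℝ),
      (∀ x y, 0 ≤ d x y) → (∀ x, d x x = 0) → (∀ x y, d x y = d y x) → (∀ x y z, d x y ≤ d x z + d z y) →
      (∀ (y : ι) (ρ : ℝ), 0 ≤ ρ → ((Finset.univ.filter (fun z => d z y ≤ ρ)).card : ℝ) ≤ cS * (1 + ρ) ^ D) →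
      ∀ (M : Matrix ι ι ℝ), M.IsSymm → (∀ v : ι → ℝ, m₀ * ∑ x, v x ^ 2 ≤ v ⬝ᵥ (M *ᵥ v)) →
        (∀ x y, |M x y| * (1 + d x y) ^ r ≤ C) →
        (∀ x y, |M⁻¹ x y| * (1 + d x y) ^ r ≤ C') ∧ (∀ y, ∑ z, |M⁻¹ z y| ≤ C') := by
  set a : ℝ := (2 : ℝ) ^ (D - r) with ha
  have ha0 : 0 < a := Real.rpow_pos_of_pos two_pos _
  have ha1 : a < 1 := Real.rpow_lt_one_of_one_lt_of_neg one_lt_two (by linarith)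
  set cS' : ℝ := cS * (2 : ℝ) ^ D * (1 - a)⁻¹ with hcS'
  have h2D : (1 : ℝ) ≤ (2 : ℝ) ^ D := Real.one_le_rpow one_le_two hD.le
  have h1a : (1 : ℝ) ≤ (1 - a)⁻¹ := (one_le_inv₀ (by linarith)).2 (by linarith)
  have hle : cS ≤ cS' := by
    calc cS = cS * 1 * 1 := by ring
      _ ≤ cS * (2 : ℝ) ^ D * (1 - a)⁻¹ :=
          mul_le_mul (mul_le_mul_of_nonneg_left h2D hcS.le) h1a zero_le_one (mul_nonneg hcS.le (by linarith))
  have hcS'0 : 0 < cS' := lt_of_lt_of_le hcS hle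
  obtain ⟨C', hC'0, h⟩ := inverse_decay_of_posDef (cS := cS') (C := C) hD hDr hcS'0 hm hC
  refine ⟨C', hC'0, ?_⟩
  intro ι _ _ d hd0 hdd hdsymm htri hG1 M hsymm hcoer hdec
  refine h d hd0 hdd hdsymm htri (fun y ρ hρ => ?_) (fun y ρ hρ => ?_) M hsymm hcoer hdec
  · exact (hG1 y ρ hρ).trans (mul_le_mul_of_nonneg_right hle (Real.rpow_nonneg (by linarith) _))
  · exact tail_sum_le_of_growth d hD.le hDr hcS.le hG1 y ρ hρ

end Summit.QuantumFields.YangMills.Theorems.AllWindowsColdBox.Jaffard
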